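import Literature.MathematicalPhysics.QuantumFieldTheory.GaussianToolkit
import Mathlib.Analysis.SpecialFunctions.Gaussian.GaussianIntegral
import Mathlib.MeasureTheory.Group.Integral
import Mathlib.MeasureTheory.Integral.Pi
import HarnessLib

/-!
# Route `SwapVirialDeficit` (YangMills): THE COUPLED TWO-PAIR GAUSSIAN — `∫ e^{−½Σ_j(Au_j² − 2Bu_jv_j + Cv_j²)} du dv = (2π∕√(AC − B²))²` by completing the square
# (cell ym-idea-1, skeleton ➎, `stub_core_tip`: generic brick of w2 g60's memo3 §6 TIP SIDE — the `(u, v)` four-block of the structured floor form is `M ⊗ I₂` with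
# `det M = AC − B²` the ONE-SOFT-PAIR determinant; free-hands support of ⟨stmt-QuantumFields-24197⟩ `SwapVirialDeficit.SwapGluedStiffness`)

Elementary Gaussian calculus, Mathlib-only (+ the Fintype Tonelli of ✓`GaussianToolkit.lintegral_fintype_prod_eq_prod`):
* `integral_exp_neg_half_sq_lin` — `∫ e^{−½(Ct² − 2βt)} dt = e^{β²∕(2C)}·√(2π∕C)` (`C > 0`; translation invariance + ✓`integral_gaussian`), with integrability;
* `integral_exp_neg_half_pair_inner ∕ _outer` — the second letter of a pair integrated out (`√(2π∕C)·e^{−½(A − B²∕C)s²}`), then the first (`2π∕√(AC − B²)`);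
* ★★ `lintegral_exp_neg_half_pairForm` — on `(Fin 2 → ℝ) × (Fin 2 → ℝ)` with the pairs `(u_j, v_j)` coupled ACROSS the two factors (the letters of the fibre blocks
  ✓`gnoFibreBlocksEquiv`): `∫⁻ e^{−½Σ_j(Au_j² − 2Bu_jv_j + Cv_j²)} = (2π∕√(AC − B²))²` (`C > 0`, `AC > B²`; Tonelli twice).

HONEST LABEL: generic Gaussian calculus; `stub_core_tip` and the other stubs, ⟨24197⟩ ∕ ⟨24194⟩ OPEN; own crux ⟨22884⟩ `LargeFieldMassRefinementTail` OPEN (blocked-on ⟨19935⟩);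
the Yang–Mills mass gap is NOT proved; no summit is proved by a line.  THEOREMS ONLY (0 `def`, 0 `sorry`, no instance), standard axioms.  Width seat ym-line-sfw-p2-w2 g61
(cell ym-idea-1, free hands), `--supports stmt-QuantumFields-24197`.  References: [cite: Breitung1994, Lemma 26]; [folklore].
-/

set_option autoImplicit false

noncomputable section

open MeasureTheory
open scoped BigOperators ENNReal

namespace Summit.QuantumFields.YangMills.Theorems.QuantitativeLaplace

/-- Completing the square in one variable: `e^{−½(Ct² − 2βt)} = e^{β²∕(2C)}·e^{−(C∕2)(t − β∕C)²}`. [folklore] -/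
theorem exp_neg_half_sq_lin_eq {C : ℝ} (hC : 0 < C) (β t : ℝ) :
    Real.exp (-(1 / 2) * (C * t ^ 2 - 2 * β * t)) = Real.exp (β ^ 2 / (2 * C)) * (fun x : ℝ => Real.exp (-(C / 2) * x ^ 2)) (t - β / C) := by
  beta_reduce
  rw [← Real.exp_add]
  congr 1
  field_simp
  ring

/-- ★ The one-dimensional Gaussian with a linear term: `∫ e^{−½(Ct² − 2βt)} dt = e^{β²∕(2C)}·√(2π∕C)` (`C > 0`). [folklore] -/
theorem integral_exp_neg_half_sq_lin {C : ℝ} (hC : 0 < C) (β : ℝ) :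
    ∫ t : ℝ, Real.exp (-(1 / 2) * (C * t ^ 2 - 2 * β * t)) = Real.exp (β ^ 2 / (2 * C)) * Real.sqrt (2 * Real.pi / C) := by
  simp_rw [exp_neg_half_sq_lin_eq hC β]
  rw [integral_const_mul, integral_sub_right_eq_self (fun x : ℝ => Real.exp (-(C / 2) * x ^ 2)) (β / C), integral_gaussian]
  congr 2
  field_simp

/-- The one-dimensional Gaussian with a linear term is integrable. [folklore] -/
theorem integrable_exp_neg_half_sq_lin {C : ℝ} (hC : 0 < C) (β : ℝ) :
    Integrable fun t : ℝ => Real.exp (-(1 / 2) * (C * t ^ 2 - 2 * β * t)) := by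
  have e : (fun t : ℝ => Real.exp (-(1 / 2) * (C * t ^ 2 - 2 * β * t))) =
      fun t => Real.exp (β ^ 2 / (2 * C)) * (fun x : ℝ => Real.exp (-(C / 2) * x ^ 2)) (t - β / C) := funext fun t => exp_neg_half_sq_lin_eq hC β t
  rw [e]
  exact ((integrable_exp_neg_mul_sq (by linarith : 0 < C / 2)).comp_sub_right (β / C)).const_mul _

/-- The pair form integrated in the second letter: `∫ e^{−½(As² − 2Bst + Ct²)} dt = √(2π∕C)·e^{−½(A − B²∕C)s²}` (`C > 0`). [folklore] -/
theorem integral_exp_neg_half_pair_inner {A B C : ℝ} (hC : 0 < C) (s : ℝ) :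
    ∫ t : ℝ, Real.exp (-(1 / 2) * (A * s ^ 2 - 2 * B * s * t + C * t ^ 2)) =
      Real.sqrt (2 * Real.pi / C) * Real.exp (-(1 / 2) * ((A - B ^ 2 / C) * s ^ 2)) := by
  have e : (fun t : ℝ => Real.exp (-(1 / 2) * (A * s ^ 2 - 2 * B * s * t + C * t ^ 2))) =
      fun t => Real.exp (-(1 / 2) * (A * s ^ 2)) * Real.exp (-(1 / 2) * (C * t ^ 2 - 2 * (B * s) * t)) := by
    funext t; rw [← Real.exp_add]; ring_nf
  rw [e, integral_const_mul, integral_exp_neg_half_sq_lin hC (B * s)]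
  rw [show Real.exp (-(1 / 2) * (A * s ^ 2)) * (Real.exp ((B * s) ^ 2 / (2 * C)) * Real.sqrt (2 * Real.pi / C)) =
      Real.sqrt (2 * Real.pi / C) * (Real.exp (-(1 / 2) * (A * s ^ 2)) * Real.exp ((B * s) ^ 2 / (2 * C))) by ring, ← Real.exp_add]
  congr 2
  field_simp
  ring

/-- The inner integrand is integrable in the second letter. [folklore] -/
theorem integrable_exp_neg_half_pair_inner {A B C : ℝ} (hC : 0 < C) (s : ℝ) :
    Integrable fun t : ℝ => Real.exp (-(1 / 2) * (A * s ^ 2 - 2 * B * s * t + C * t ^ 2)) := by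
  have e : (fun t : ℝ => Real.exp (-(1 / 2) * (A * s ^ 2 - 2 * B * s * t + C * t ^ 2))) =
      fun t => Real.exp (-(1 / 2) * (A * s ^ 2)) * Real.exp (-(1 / 2) * (C * t ^ 2 - 2 * (B * s) * t)) := by
    funext t; rw [← Real.exp_add]; ring_nf
  rw [e]
  exact (integrable_exp_neg_half_sq_lin hC (B * s)).const_mul _

/-- The outer Gaussian: `∫ √(2π∕C)·e^{−½(A − B²∕C)s²} ds = 2π∕√(AC − B²)` (`C > 0`, `AC > B²`). [folklore] -/
theorem integral_exp_neg_half_pair_outer {A B C : ℝ} (hC : 0 < C) (hD : 0 < A * C - B ^ 2) :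
    ∫ s : ℝ, Real.sqrt (2 * Real.pi / C) * Real.exp (-(1 / 2) * ((A - B ^ 2 / C) * s ^ 2)) = 2 * Real.pi / Real.sqrt (A * C - B ^ 2) := by
  have hAC : 0 < A - B ^ 2 / C := by
    have : A - B ^ 2 / C = (A * C - B ^ 2) / C := by field_simp
    rw [this]; positivity
  have e : (fun s : ℝ => Real.sqrt (2 * Real.pi / C) * Real.exp (-(1 / 2) * ((A - B ^ 2 / C) * s ^ 2))) =
      fun s => Real.sqrt (2 * Real.pi / C) * Real.exp (-((A - B ^ 2 / C) / 2) * s ^ 2) := by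
    funext s; congr 1; ring_nf
  rw [e, integral_const_mul, integral_gaussian, ← Real.sqrt_mul (by positivity)]
  have hin : 2 * Real.pi / C * (Real.pi / ((A - B ^ 2 / C) / 2)) = (2 * Real.pi) ^ 2 / (A * C - B ^ 2) := by
    field_simp
  rw [hin]
  rw [Real.sqrt_div (sq_nonneg _)]
  rw [Real.sqrt_sq (by positivity)]

/-- The outer integrand is integrable. [folklore] -/
theorem integrable_exp_neg_half_pair_outer {A B C : ℝ} (hC : 0 < C) (hD : 0 < A * C - B ^ 2) :
    Integrable fun s : ℝ => Real.sqrt (2 * Real.pi / C) * Real.exp (-(1 / 2) * ((A - B ^ 2 / C) * s ^ 2)) := by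
  have hAC : 0 < A - B ^ 2 / C := by
    have : A - B ^ 2 / C = (A * C - B ^ 2) / C := by field_simp
    rw [this]; positivity
  have e : (fun s : ℝ => Real.sqrt (2 * Real.pi / C) * Real.exp (-(1 / 2) * ((A - B ^ 2 / C) * s ^ 2))) =
      fun s => Real.sqrt (2 * Real.pi / C) * Real.exp (-((A - B ^ 2 / C) / 2) * s ^ 2) := by
    funext s; congr 1; ring_nf
  rw [e]
  exact (integrable_exp_neg_mul_sq (by positivity : 0 < (A - B ^ 2 / C) / 2)).const_mul _

set_option maxHeartbeats 1600000 in
/-- ★★ **THE COUPLED TWO-PAIR GAUSSIAN** on `(Fin 2 → ℝ) × (Fin 2 → ℝ)` (pairs `(u_j, v_j)`, `j = 0, 1`, coupled ACROSS the two factors):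
`∫⁻ e^{−½ Σ_j (A u_j² − 2B u_j v_j + C v_j²)} = (2π∕√(AC − B²))²` (`C > 0`, `AC > B²`; Tonelli twice + completing the square). [folklore] -/
theorem lintegral_exp_neg_half_pairForm {A B C : ℝ} (hC : 0 < C) (hD : 0 < A * C - B ^ 2) :
    ∫⁻ q : (Fin 2 → ℝ) × (Fin 2 → ℝ), ENNReal.ofReal (Real.exp (-(1 / 2) * ∑ j, (A * q.1 j ^ 2 - 2 * B * q.1 j * q.2 j + C * q.2 j ^ 2))) =
      ENNReal.ofReal ((2 * Real.pi / Real.sqrt (A * C - B ^ 2)) ^ 2) := by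
  -- the integrand as a product over `j`
  set G : ℝ → ℝ → ℝ := fun s t => Real.exp (-(1 / 2) * (A * s ^ 2 - 2 * B * s * t + C * t ^ 2)) with hG
  have hGpos : ∀ s t, 0 < G s t := fun s t => Real.exp_pos _
  have hGcont : Continuous fun q : ℝ × ℝ => G q.1 q.2 := by
    rw [hG]; fun_prop
  have hprod : ∀ q : (Fin 2 → ℝ) × (Fin 2 → ℝ), ENNReal.ofReal (Real.exp (-(1 / 2) * ∑ j, (A * q.1 j ^ 2 - 2 * B * q.1 j * q.2 j + C * q.2 j ^ 2))) =
      ∏ j, ENNReal.ofReal (G (q.1 j) (q.2 j)) := fun q => by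
    rw [← ENNReal.ofReal_prod_of_nonneg (fun j _ => (hGpos _ _).le), hG]
    simp only [← Real.exp_sum, Finset.mul_sum]
  simp_rw [hprod]
  -- Tonelli on the product of the two factors
  have hmeas : Measurable fun q : (Fin 2 → ℝ) × (Fin 2 → ℝ) => ∏ j, ENNReal.ofReal (G (q.1 j) (q.2 j)) := by
    refine Finset.measurable_prod _ fun j _ => ENNReal.measurable_ofReal.comp ?_
    have h2 : Measurable fun q : (Fin 2 → ℝ) × (Fin 2 → ℝ) => (q.1 j, q.2 j) :=
      ((measurable_pi_apply j).comp measurable_fst).prodMk ((measurable_pi_apply j).comp measurable_snd)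
    exact hGcont.measurable.comp h2
  rw [MeasureTheory.Measure.volume_eq_prod, lintegral_prod _ hmeas.aemeasurable]
  -- the inner integral over `v` at fixed `u`
  have hinner : ∀ u : Fin 2 → ℝ, ∫⁻ v : Fin 2 → ℝ, ∏ j, ENNReal.ofReal (G (u j) (v j)) =
      ∏ j : Fin 2, ENNReal.ofReal (Real.sqrt (2 * Real.pi / C) * Real.exp (-(1 / 2) * ((A - B ^ 2 / C) * u j ^ 2))) := fun u => by
    have hm : ∀ j : Fin 2, Measurable fun t : ℝ => ENNReal.ofReal (G (u j) t) := fun j =>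
      ENNReal.measurable_ofReal.comp (hGcont.measurable.comp (measurable_const.prodMk measurable_id))
    rw [MeasureTheory.volume_pi,
      Literature.MathematicalPhysics.QuantumFieldTheory.GaussianToolkit.lintegral_fintype_prod_eq_prod (fun _ : Fin 2 => (volume : Measure ℝ))
        (f := fun j t => ENNReal.ofReal (G (u j) t)) hm]
    refine Finset.prod_congr rfl fun j _ => ?_
    rw [← ofReal_integral_eq_lintegral_ofReal (integrable_exp_neg_half_pair_inner hC (u j)) (ae_of_all _ fun t => (hGpos _ _).le),
      integral_exp_neg_half_pair_inner hC (u j)]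
  simp_rw [hinner]
  -- the outer integral over `u`
  have hm2 : ∀ j : Fin 2, Measurable fun s : ℝ => ENNReal.ofReal (Real.sqrt (2 * Real.pi / C) * Real.exp (-(1 / 2) * ((A - B ^ 2 / C) * s ^ 2))) := fun j => by
    refine ENNReal.measurable_ofReal.comp ?_
    fun_prop
  rw [MeasureTheory.volume_pi,
    Literature.MathematicalPhysics.QuantumFieldTheory.GaussianToolkit.lintegral_fintype_prod_eq_prod (fun _ : Fin 2 => (volume : Measure ℝ))
      (f := fun _ s => ENNReal.ofReal (Real.sqrt (2 * Real.pi / C) * Real.exp (-(1 / 2) * ((A - B ^ 2 / C) * s ^ 2)))) hm2]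
  have hpos2 : ∀ s : ℝ, 0 ≤ Real.sqrt (2 * Real.pi / C) * Real.exp (-(1 / 2) * ((A - B ^ 2 / C) * s ^ 2)) := fun s => by positivity
  rw [← ofReal_integral_eq_lintegral_ofReal (integrable_exp_neg_half_pair_outer hC hD) (ae_of_all _ hpos2), integral_exp_neg_half_pair_outer hC hD,
    Finset.prod_const, Finset.card_univ, Fintype.card_fin, ← ENNReal.ofReal_pow (by positivity)]

end Summit.QuantumFields.YangMills.Theorems.QuantitativeLaplace

end
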